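/-
Copyright (c) 2026 the pub-hodgecm-mathlib formalisation cell (harness21).  Prover seat hodgecm-mathlib-K2E1-p02 (g4), Track B ∕ K2-LIT, h413 =
`stmt-HodgeConjecture-24833`, line `K2_E1_TraceFormulaBeta`; DEAL H ∕ brick (H1) of the dealer K2E1-plan (g2) 2026-09-04T02:12:50Z (campaign «RES-RANK-ONE»):
FILE A of the ADMISSIBILITY ENTRANCE — admissibility on irreducible `K`-types makes every `K`-finite smear `σ(ψ)` a FINITE-RANK operator.
-/
import Literature.NumberTheory.Automorphic.CompactGroupKFiniteVectorsPeterWeyl     -- ★ `smear`, `apply_smear`, `leftTranslate`, `IsTranslationFinite`, `smear_eq_integratedOperator`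
import Literature.NumberTheory.Automorphic.UnitaryIsotypicProjection               -- ★ `Representation.homRangeSum`, `ContRepresentation.subRep`, `isIrreducible_subRep_of_minimal`
import Literature.RepresentationTheory.CompactGroups.FiniteDimensionalSemisimple    -- ★ `exists_isCompl_subrepresentation_of_continuous` (Weyl's unitarian trick)
import HarnessLib

/-!
# K2·E1 — `K2E1AdmissibleSmearFiniteRank`: ADMISSIBILITY ON IRREDUCIBLE `K`-TYPES ⇒ THE `τ`-PART IS FINITE-DIMENSIONAL FOR EVERY
# FINITE-DIMENSIONAL CONTINUOUS `τ` ⇒ THE SMEAR `σ(ψ) = ∫_K ψ(k) σ(k) dk` OF EVERY `K`-FINITE `ψ` HAS FINITE RANK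

Track B ∕ K2-LIT, crux h413 = `stmt-HodgeConjecture-24833`, route of record `HCCMUnconditional`; cell `hodgecm-mathlib`, squad K2, ENGINE E1 (line
`K2_E1_TraceFormulaBeta`, socket module `K2_E1_TraceFormulaBetaSigs_GlobalIndex`, live sockets 5Res `sig_K2E1ResidualCompactU2` :252 ∕ 12R3
`sig_K2E1ResidualCompactU3R` :297 = ★ `CmResidualSpectrumCompactR L N μ`).  Prover seat `hodgecm-mathlib-K2E1-p02` (g4); DEAL H, brick (H1) «THE ADMISSIBILITY
ENTRANCE» of the campaign «RES-RANK-ONE» adopted by the dealer K2E1-plan (g2) 2026-09-04T02:12:50Z on the survey memo `K2/K2E1-p02/g4/SPEC-residual-rank-one.md`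
(002a137abb1c63af).  THEOREMS ONLY (no `def`, no `instance`, no notation, no named-fact hypothesis, no `sorry`); lane `--supports stmt-HodgeConjecture-24833
--as helper` (count-neutral).  This is FILE A (pure compact-group functional analysis); FILE B `K2E1ResidualCompactOfAdmissible` turns it into
«`L²_res` is `K_∞K_f`-admissible ⇒ ★ `ResidualSpectrumCompact`».

WHAT.  Let `K` be a compact Hausdorff group, `σ` a representation of `K` on a complex Hilbert space `H`, and assume ADMISSIBILITY ON IRREDUCIBLE `K`-TYPES in
the tree's currency (the hypothesis `hadm` of ★ `ContRepresentation.IsUnitary.isDiscretelyDecomposable_of_finiteDimensional_homRangeSum`): every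
finite-dimensional `σ`-stable `E ≤ H` on which `σ` is irreducible has a finite-dimensional isotypic part `E(σ|_E) = Σ_{T ∈ Hom_K(σ|_E, σ)} im T`
(★ `Representation.homRangeSum`).  Then:
* §1 `finiteDimensional_homRangeSum_of_admissible` — for EVERY finite-dimensional weakly continuous representation `ρ` of `K` (all matrix coefficients
  `k ↦ ℓ(ρ(k)v)` continuous) the `ρ`-part `Σ_{T ∈ Hom_K(ρ, σ)} im T` of `σ` is finite-dimensional [Wallach RRG I §3.3.1: admissibility].  Proof by induction
  on `dim ρ`: if `ρ` is irreducible, a non-zero `K`-map `T₀ : ρ → σ` is injective (Mathlib `Representation.IsIrreducible.injective_or_eq_zero`), its image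
  `E` is an irreducible `K`-type of `σ` (★ `isIrreducible_subRep_of_minimal`) and every `K`-map `ρ → σ` factors as a `K`-map `σ|_E → σ` through
  `T₀ : ρ ≃ E`, so the `ρ`-part is the `E`-part, finite-dimensional by `hadm`; otherwise `ρ = ρ₁ ⊕ ρ₂` with proper invariant COMPLEMENTS (Weyl's unitarian
  trick, ★ `Literature.RepresentationTheory.CompactGroups.exists_isCompl_subrepresentation_of_continuous`) and the `ρ`-part lies in the sum of the two parts.
* §2 `smear_mem_homRangeSum` ∕ `exists_finiteDimensional_forall_smear_mem` — for a `K`-finite continuous `ψ` (★ `IsTranslationFinite`: the left translates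
  `λ(k)ψ` span a finite-dimensional space `F_ψ ≤ C(K, ℂ)`) and a left Haar measure `μ`, the smears `σ(ψ)v = ∫ ψ(k) σ(k)v dμ` (★ `smear`) of ALL `v ∈ H` lie
  in ONE finite-dimensional subspace: `v ↦ σ(·)v` restricted to `F_ψ` is a `K`-map from the (weakly continuous, finite-dimensional) left regular
  representation on `F_ψ` (★ `apply_smear`: `σ(k)σ(ψ)v = σ(λ(k)ψ)v`), so `σ(ψ)v` lies in the `F_ψ`-part of `σ`, finite-dimensional by §1.
* §3 `isCompactOperator_integratedOperator_of_isTranslationFinite` — hence, for unitary strongly continuous `σ`, the operator `σ(ψ)` (★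
  `ContRepresentation.integratedOperator`, = the smear by ★ `smear_eq_integratedOperator`) has finite rank and is COMPACT.
HONEST LABEL: HC_CM is proved only modulo the 7 printed citations (2 remaining named inputs: hLiu418 = `stmt-HodgeConjecture-24832`, h413 =
`stmt-HodgeConjecture-24833`) until rung 0 closes; this file asserts no named fact and closes no socket.
References: [WallachRRG1] N. R. Wallach, *Real Reductive Groups I* (1988), §1.4.7, §3.3.1 · [HarishChandraTAMS1953] Harish-Chandra, Trans. AMS 75 (1953), §9 Thm. 4 ·
[BrockerTomDieck1985] Th. Bröcker, T. tom Dieck, *Representations of Compact Lie Groups* (1985), II (1.7), (1.9); III (5.5)–(5.7) · [DeitmarEchterhoff2014]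
A. Deitmar, S. Echterhoff, *Principles of Harmonic Analysis*, 2nd ed. (2014), Prop. 6.2.1, §7.3.
-/

set_option autoImplicit false
-- the mandated namespace repeats the single-problem summit's segment (`HodgeConjecture.HodgeConjecture`)
set_option linter.dupNamespace false

noncomputable section

open MeasureTheory Filter Topology
open scoped InnerProductSpace
open Literature.NumberTheory.Automorphic

namespace Summit.HodgeConjecture.HodgeConjecture.Cruxes.H413.K2E1AdmissibleSmearFiniteRank

universe v

/-! ## §1 Admissibility on irreducible `K`-types ⇒ the `ρ`-part is finite-dimensional for every finite-dimensional continuous `ρ` -/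

section Algebra

variable {K : Type*} [Group K] [TopologicalSpace K] [IsTopologicalGroup K] [CompactSpace K]
  {H : Type*} [NormedAddCommGroup H] [InnerProductSpace ℂ H]
  {σ : ContRepresentation ℂ K H}

omit [TopologicalSpace K] [IsTopologicalGroup K] [CompactSpace K] in
/-- The `ρ`-part of `σ` lies in the sum of the `ρ|_{S₁}`- and `ρ|_{S₂}`-parts as soon as `S₁ + S₂` is everything: a `K`-map `T : ρ → σ` restricts to
`K`-maps on `S₁`, `S₂`, and `T x = T a + T b` for `x = a + b`. [cite: WallachRRG1, §1.4.7] -/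
theorem homRangeSum_le_sup_of_codisjoint {V : Type v} [AddCommGroup V] [Module ℂ V] (ρ : Representation ℂ K V)
    (S₁ S₂ : Subrepresentation ρ) (h : ∀ x : V, ∃ a ∈ S₁.toSubmodule, ∃ b ∈ S₂.toSubmodule, a + b = x) :
    Representation.homRangeSum σ.toRepresentation ρ ≤
      Representation.homRangeSum σ.toRepresentation S₁.toRepresentation ⊔ Representation.homRangeSum σ.toRepresentation S₂.toRepresentation := by
  -- the inclusions `S_i ↪ V` as `K`-maps
  let ι₁ : S₁.toRepresentation.IntertwiningMap ρ :=
    S₁.toSubmodule.subtype.intertwiningMap_of_isIntertwiningMap S₁.toRepresentation ρ fun k w => rfl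
  let ι₂ : S₂.toRepresentation.IntertwiningMap ρ :=
    S₂.toSubmodule.subtype.intertwiningMap_of_isIntertwiningMap S₂.toRepresentation ρ fun k w => rfl
  refine iSup_le fun T => ?_
  rintro _ ⟨x, rfl⟩
  obtain ⟨a, ha, b, hb, hab⟩ := h x
  have hx : T.toLinearMap x = (T.comp ι₁) ⟨a, ha⟩ + (T.comp ι₂) ⟨b, hb⟩ := by
    rw [← hab, Representation.IntertwiningMap.toLinearMap_apply, map_add]
    rfl
  rw [hx]
  exact Submodule.add_mem_sup (Representation.apply_mem_homRangeSum _ _) (Representation.apply_mem_homRangeSum _ _)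

omit [TopologicalSpace K] [IsTopologicalGroup K] [CompactSpace K] in
/-- If `ρ` is IRREDUCIBLE, its part in `σ` is either `⊥` or the part of one irreducible `K`-type `E ≤ H` of `σ` (the image of a non-zero, hence injective,
`K`-map `T₀ : ρ → σ`): every `K`-map `ρ → σ` factors through `T₀ : ρ ≃ E`.  Under admissibility on irreducible `K`-types the `ρ`-part is therefore
finite-dimensional. [cite: WallachRRG1, §1.4.7 and §3.3.1] [cite: HarishChandraTAMS1953, §9 Thm. 4] -/
theorem finiteDimensional_homRangeSum_of_isIrreducible
    (hadm : ∀ (E : Submodule ℂ H) (hE : ∀ k, ∀ x ∈ E, σ k x ∈ E), FiniteDimensional ℂ E → (σ.subRep E hE).IsIrreducible →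
      FiniteDimensional ℂ (Representation.homRangeSum σ.toRepresentation (σ.subRep E hE)))
    {V : Type v} [AddCommGroup V] [Module ℂ V] [FiniteDimensional ℂ V] (ρ : Representation ℂ K V) (hirr : ρ.IsIrreducible) :
    FiniteDimensional ℂ (Representation.homRangeSum σ.toRepresentation ρ) := by
  classical
  by_cases hzero : ∀ T : ρ.IntertwiningMap σ.toRepresentation, T = 0
  · -- no non-zero `K`-map: the `ρ`-part is `⊥`
    have hle : Representation.homRangeSum σ.toRepresentation ρ ≤ ⊥ := by
      refine iSup_le fun T => ?_
      rintro _ ⟨x, rfl⟩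
      rw [hzero T]
      exact (Submodule.mem_bot ℂ).2 rfl
    exact Submodule.finiteDimensional_of_le hle
  push Not at hzero
  obtain ⟨T₀, hT₀⟩ := hzero
  haveI : ρ.IsIrreducible := hirr
  -- `T₀` is injective
  have hinj : Function.Injective T₀ := (Representation.IsIrreducible.injective_or_eq_zero T₀).resolve_right hT₀
  have hinj' : Function.Injective T₀.toLinearMap := fun a b hab => hinj hab
  -- its image `E`, an irreducible `K`-type of `σ`
  set E : Submodule ℂ H := LinearMap.range T₀.toLinearMap with hE_def
  have hE : ∀ k, ∀ x ∈ E, σ k x ∈ E := fun k x hx => T₀.range.apply_mem_toSubmodule k hx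
  have hEne : E ≠ ⊥ := by
    intro h
    apply hT₀
    refine Representation.IntertwiningMap.ext ?_
    exact LinearMap.range_eq_bot.1 h
  have hEmin : ∀ U : Submodule ℂ H, (∀ k, ∀ u ∈ U, σ k u ∈ U) → U ≤ E → U = ⊥ ∨ U = E := by
    intro U hU hUE
    -- the preimage of `U` is a subrepresentation of the irreducible `ρ`
    let P : Subrepresentation ρ :=
      { toSubmodule := U.comap T₀.toLinearMap
        apply_mem_toSubmodule := fun k x hx => by
          change T₀.toLinearMap (ρ k x) ∈ U
          rw [Representation.IntertwiningMap.toLinearMap_apply, Representation.IntertwiningMap.isIntertwining]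
          exact hU k _ hx }
    rcases IsSimpleOrder.eq_bot_or_eq_top P with hP | hP
    · left
      refine (Submodule.eq_bot_iff _).2 fun u hu => ?_
      obtain ⟨x, rfl⟩ := hUE hu
      have hx : x ∈ P := hu
      rw [hP] at hx
      have hx0 : x = 0 := hx
      rw [hx0, map_zero]
    · right
      refine le_antisymm hUE ?_
      rintro _ ⟨x, rfl⟩
      have hx : x ∈ P := by rw [hP]; trivial
      exact hx
  have hEirr : (σ.subRep E hE).IsIrreducible := ContRepresentation.isIrreducible_subRep_of_minimal hE hEne hEmin
  haveI hfin : FiniteDimensional ℂ (Representation.homRangeSum σ.toRepresentation (σ.subRep E hE)) := hadm E hE inferInstance hEirr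
  -- `T₀ : V ≃ E`
  let e : V ≃ₗ[ℂ] E := LinearEquiv.ofInjective T₀.toLinearMap hinj'
  have he : ∀ x : V, ((e x : E) : H) = T₀ x := fun x => rfl
  -- every `K`-map `T : ρ → σ` factors through `σ|_E`
  have key : ∀ T : ρ.IntertwiningMap σ.toRepresentation,
      LinearMap.range T.toLinearMap ≤ Representation.homRangeSum σ.toRepresentation (σ.subRep E hE) := by
    intro T
    let G : (σ.subRep E hE).IntertwiningMap σ.toRepresentation :=
      (T.toLinearMap ∘ₗ e.symm.toLinearMap).intertwiningMap_of_isIntertwiningMap (σ.subRep E hE) σ.toRepresentation fun k y => by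
        obtain ⟨x, rfl⟩ := e.surjective y
        have h1 : (σ.subRep E hE) k (e x) = e (ρ k x) := by
          apply Subtype.ext
          change σ k ((e x : E) : H) = ((e (ρ k x) : E) : H)
          rw [he, he]
          exact (Representation.IntertwiningMap.isIntertwining ρ σ.toRepresentation T₀ k x).symm
        rw [h1]
        change T.toLinearMap (e.symm (e (ρ k x))) = σ k (T.toLinearMap (e.symm (e x)))
        rw [e.symm_apply_apply, e.symm_apply_apply, Representation.IntertwiningMap.toLinearMap_apply,
          Representation.IntertwiningMap.toLinearMap_apply]
        exact Representation.IntertwiningMap.isIntertwining ρ σ.toRepresentation T k x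
    rintro _ ⟨x, rfl⟩
    have hx : T.toLinearMap x = G (e x) := by
      change T.toLinearMap x = T.toLinearMap (e.symm (e x))
      rw [e.symm_apply_apply]
    rw [hx]
    exact Representation.apply_mem_homRangeSum G (e x)
  exact Submodule.finiteDimensional_of_le (iSup_le key)

omit [IsTopologicalGroup K] [CompactSpace K] in
/-- Weak continuity passes to subrepresentations (compose the matrix coefficient with a linear retraction `V → S`). [folklore] -/
theorem weaklyContinuous_toRepresentation {V : Type v} [AddCommGroup V] [Module ℂ V] (ρ : Representation ℂ K V)
    (hρ : ∀ (v : V) (ℓ : Module.Dual ℂ V), Continuous fun k : K => ℓ (ρ k v)) (S : Subrepresentation ρ)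
    (v : S.toSubmodule) (ℓ : Module.Dual ℂ S.toSubmodule) : Continuous fun k : K => ℓ (S.toRepresentation k v) := by
  obtain ⟨r, hr⟩ := S.toSubmodule.subtype.exists_leftInverse_of_injective (LinearMap.ker_eq_bot.2 Subtype.val_injective)
  have h : (fun k : K => ℓ (S.toRepresentation k v)) = fun k => (ℓ ∘ₗ r) (ρ k (v : V)) := by
    funext k
    have h1 : r ((S.toRepresentation k v : S.toSubmodule) : V) = S.toRepresentation k v := by
      have := LinearMap.congr_fun hr (S.toRepresentation k v)
      simpa using this
    rw [LinearMap.comp_apply]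
    congr 1
    exact h1.symm
  rw [h]
  exact hρ _ _

/-- **ADMISSIBILITY ON IRREDUCIBLE `K`-TYPES ⇒ THE `ρ`-PART IS FINITE-DIMENSIONAL FOR EVERY FINITE-DIMENSIONAL CONTINUOUS `ρ`.**  `K` compact, `σ` a
representation on a complex inner-product space `H` such that every finite-dimensional irreducible `σ`-stable `E ≤ H` has finite-dimensional isotypic part
`Σ_{T ∈ Hom_K(σ|_E,σ)} im T` (★ `hadm` currency).  Then for every finite-dimensional WEAKLY CONTINUOUS representation `ρ` of `K` (matrix coefficients
`k ↦ ℓ(ρ(k)v)` continuous) the `ρ`-part `Σ_{T ∈ Hom_K(ρ,σ)} im T` (★ `Representation.homRangeSum`) is finite-dimensional — induction on `dim ρ` with invariant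
complements from Weyl's unitarian trick (★ `exists_isCompl_subrepresentation_of_continuous`) and the irreducible case above.
[cite: WallachRRG1, §3.3.1] [cite: BrockerTomDieck1985, II (1.7) and (1.9)] [cite: HarishChandraTAMS1953, §9 Thm. 4] -/
theorem finiteDimensional_homRangeSum_of_admissible
    (hadm : ∀ (E : Submodule ℂ H) (hE : ∀ k, ∀ x ∈ E, σ k x ∈ E), FiniteDimensional ℂ E → (σ.subRep E hE).IsIrreducible →
      FiniteDimensional ℂ (Representation.homRangeSum σ.toRepresentation (σ.subRep E hE)))
    {V : Type v} [AddCommGroup V] [Module ℂ V] [FiniteDimensional ℂ V] (ρ : Representation ℂ K V)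
    (hρ : ∀ (v : V) (ℓ : Module.Dual ℂ V), Continuous fun k : K => ℓ (ρ k v)) :
    FiniteDimensional ℂ (Representation.homRangeSum σ.toRepresentation ρ) := by
  -- strong induction on the dimension, over all finite-dimensional weakly continuous `ρ` in the universe of `V`
  suffices main : ∀ (n : ℕ) (W : Type v) [AddCommGroup W] [Module ℂ W] [FiniteDimensional ℂ W] (ρ : Representation ℂ K W),
      (∀ (w : W) (ℓ : Module.Dual ℂ W), Continuous fun k : K => ℓ (ρ k w)) → Module.finrank ℂ W ≤ n →
        FiniteDimensional ℂ (Representation.homRangeSum σ.toRepresentation ρ) from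
    main _ V ρ hρ le_rfl
  intro n
  induction n with
  | zero =>
    intro W _ _ _ ρ _ hn
    haveI : Subsingleton W := Module.finrank_zero_iff.1 (Nat.le_zero.1 hn)
    have hle : Representation.homRangeSum σ.toRepresentation ρ ≤ ⊥ := by
      refine iSup_le fun T => ?_
      rintro _ ⟨x, rfl⟩
      rw [Subsingleton.elim x 0, map_zero]
      exact zero_mem _
    exact Submodule.finiteDimensional_of_le hle
  | succ n ih =>
    intro W _ _ _ ρ hρW hn
    by_cases hirr : ρ.IsIrreducible
    · exact finiteDimensional_homRangeSum_of_isIrreducible hadm ρ hirr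
    by_cases htriv : Subsingleton W
    · exact ih W ρ hρW (by rw [Module.finrank_zero_of_subsingleton]; exact Nat.zero_le _)
    -- a proper non-trivial subrepresentation `S₁`
    haveI : Nontrivial W := not_subsingleton_iff_nontrivial.1 htriv
    haveI : Nontrivial (Subrepresentation ρ) := ⟨⟨⊥, ⊤, fun h => bot_ne_top (congrArg Subrepresentation.toSubmodule h)⟩⟩
    have hex : ∃ S₁ : Subrepresentation ρ, S₁ ≠ ⊥ ∧ S₁ ≠ ⊤ := by
      by_contra hcon
      push Not at hcon
      have hall : ∀ S : Subrepresentation ρ, S = ⊥ ∨ S = ⊤ := fun S => by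
        by_cases hS : S = ⊥
        · exact Or.inl hS
        · exact Or.inr (hcon S hS)
      exact hirr { eq_bot_or_eq_top := hall }
    obtain ⟨S₁, hS₁bot, hS₁top⟩ := hex
    -- an invariant complement `S₂` (Weyl's unitarian trick)
    obtain ⟨S₂, hS⟩ := Literature.RepresentationTheory.CompactGroups.exists_isCompl_subrepresentation_of_continuous ρ hρW S₁
    have hsup : S₁.toSubmodule ⊔ S₂.toSubmodule = ⊤ := by
      have := congrArg Subrepresentation.toSubmodule hS.sup_eq_top
      rw [Subrepresentation.toSubmodule_sup] at this
      exact this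
    have hinf : S₁.toSubmodule ⊓ S₂.toSubmodule = ⊥ := by
      have := congrArg Subrepresentation.toSubmodule hS.inf_eq_bot
      rw [Subrepresentation.toSubmodule_inf] at this
      exact this
    -- dimensions
    have hdim : Module.finrank ℂ S₁.toSubmodule + Module.finrank ℂ S₂.toSubmodule = Module.finrank ℂ W := by
      have h := Submodule.finrank_sup_add_finrank_inf_eq S₁.toSubmodule S₂.toSubmodule
      rw [hsup, hinf, finrank_bot, finrank_top, add_zero] at h
      exact h.symm
    have hS₁pos : 0 < Module.finrank ℂ S₁.toSubmodule := by
      rw [pos_iff_ne_zero, Ne, Submodule.finrank_eq_zero]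
      exact fun h => hS₁bot (Subrepresentation.toSubmodule_injective h)
    have hS₂pos : 0 < Module.finrank ℂ S₂.toSubmodule := by
      rw [pos_iff_ne_zero, Ne, Submodule.finrank_eq_zero]
      intro h
      apply hS₁top
      apply Subrepresentation.toSubmodule_injective
      have : S₂.toSubmodule = ⊥ := h
      rw [this, sup_bot_eq] at hsup
      exact hsup
    haveI h₁ : FiniteDimensional ℂ (Representation.homRangeSum σ.toRepresentation S₁.toRepresentation) :=
      ih S₁.toSubmodule S₁.toRepresentation (weaklyContinuous_toRepresentation ρ hρW S₁) (by omega)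
    haveI h₂ : FiniteDimensional ℂ (Representation.homRangeSum σ.toRepresentation S₂.toRepresentation) :=
      ih S₂.toSubmodule S₂.toRepresentation (weaklyContinuous_toRepresentation ρ hρW S₂) (by omega)
    refine Submodule.finiteDimensional_of_le (homRangeSum_le_sup_of_codisjoint ρ S₁ S₂ fun x => ?_)
    have hx : x ∈ S₁.toSubmodule ⊔ S₂.toSubmodule := by rw [hsup]; trivial
    obtain ⟨a, ha, b, hb, hab⟩ := Submodule.mem_sup.1 hx
    exact ⟨a, ha, b, hb, hab⟩

end Algebra

/-! ## §2 The smear of a `K`-finite function has its values in ONE finite-dimensional subspace -/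

section Smear

variable {K : Type*} [TopologicalSpace K] [Group K] [IsTopologicalGroup K] [CompactSpace K]
  [MeasurableSpace K] [BorelSpace K]
  {H : Type*} [NormedAddCommGroup H] [InnerProductSpace ℂ H] [CompleteSpace H]
  {σ : ContRepresentation ℂ K H} {μ : Measure K} [IsFiniteMeasureOnCompacts μ] [μ.IsMulLeftInvariant]

omit [CompactSpace K] [MeasurableSpace K] [BorelSpace K] in
/-- Strong continuity of the left regular representation on `C(K, ℂ)`: `k ↦ λ(k)ψ` is continuous (the curried form of the continuous map
`(k, x) ↦ ψ(k⁻¹x)`, Mathlib `ContinuousMap.curry`). [cite: BrockerTomDieck1985, III (5.5)] -/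
theorem continuous_leftTranslate (ψ : C(K, ℂ)) : Continuous fun k : K => leftTranslate k ψ := by
  let F : C(K × K, ℂ) := ⟨fun p => ψ (p.1⁻¹ * p.2), ψ.continuous.comp (continuous_fst.inv.mul continuous_snd)⟩
  have h : (fun k : K => leftTranslate k ψ) = fun k => F.curry k := by
    funext k
    ext x
    rfl
  rw [h]
  exact F.curry.continuous

omit [CompactSpace K] [MeasurableSpace K] [BorelSpace K] in
/-- The span of the left translates of `ψ` is stable under left translation (`λ(k)λ(g)ψ = λ(kg)ψ`). [folklore] -/
theorem leftTranslate_mem_span_range (ψ : C(K, ℂ)) (k : K) {φ : C(K, ℂ)}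
    (hφ : φ ∈ Submodule.span ℂ (Set.range fun g : K => leftTranslate g ψ)) :
    leftTranslate k φ ∈ Submodule.span ℂ (Set.range fun g : K => leftTranslate g ψ) := by
  induction hφ using Submodule.span_induction with
  | mem x hx =>
    obtain ⟨g, rfl⟩ := hx
    rw [← leftTranslate_mul_left]
    exact Submodule.subset_span ⟨k * g, rfl⟩
  | zero =>
    have : leftTranslate k (0 : C(K, ℂ)) = 0 := by ext x; rfl
    rw [this]
    exact zero_mem _
  | add x y _ _ hx hy =>
    rw [leftTranslate_add]
    exact add_mem hx hy
  | smul c x _ hx =>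
    rw [leftTranslate_smul]
    exact Submodule.smul_mem _ c hx

/-- **THE SMEAR OF A `K`-FINITE FUNCTION LIES IN THE `F_ψ`-PART OF `σ`.**  Let `σ` be strongly continuous, `μ` a left Haar measure on `K`, `ψ ∈ C(K, ℂ)` and
`F ≤ C(K, ℂ)` a finite-dimensional subspace stable under left translation with `ψ ∈ F` (e.g. the span of the translates of a `K`-finite `ψ`).  Then for
every `v ∈ H` the smear `σ(ψ)v = ∫ ψ(k)σ(k)v dμ` (★ `smear`) lies in the `F`-part `Σ_{T ∈ Hom_K(λ_F, σ)} im T` of `σ`, `λ_F` the left regular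
representation on `F` (Mathlib `ContRepresentation.coind₁` of the trivial representation, ★ `leftTranslate_eq_coind₁`): `φ ↦ σ(φ)v` is a `K`-map
`λ_F → σ` by ★ `apply_smear`. [cite: BrockerTomDieck1985, III (5.5)–(5.6)] [cite: WallachRRG1, §1.4.7] -/
theorem smear_mem_homRangeSum (hc : σ.IsStronglyContinuous) (F : Submodule ℂ C(K, ℂ)) (hF : ∀ k, ∀ φ ∈ F, leftTranslate k φ ∈ F)
    {ψ : C(K, ℂ)} (hψ : ψ ∈ F) (v : H) :
    smear σ μ ψ v ∈ Representation.homRangeSum σ.toRepresentation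
      ((⟨F, fun k φ hφ => hF k φ hφ⟩ : Subrepresentation ((ContRepresentation.trivial ℂ K ℂ).coind₁).toRepresentation).toRepresentation) := by
  -- `φ ↦ σ(φ)v` restricted to `F` is a `K`-map
  let T : ((⟨F, fun k φ hφ => hF k φ hφ⟩ : Subrepresentation ((ContRepresentation.trivial ℂ K ℂ).coind₁).toRepresentation).toRepresentation).IntertwiningMap
      σ.toRepresentation :=
    ((smearₗ σ μ hc v) ∘ₗ F.subtype).intertwiningMap_of_isIntertwiningMap _ σ.toRepresentation fun k φ => by
      change smear σ μ (leftTranslate k (φ : C(K, ℂ))) v = σ k (smear σ μ (φ : C(K, ℂ)) v)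
      rw [apply_smear hc]
  have h : smear σ μ ψ v = T ⟨ψ, hψ⟩ := rfl
  rw [h]
  exact Representation.apply_mem_homRangeSum T ⟨ψ, hψ⟩

/-- **ALL SMEARS BY A `K`-FINITE FUNCTION LIE IN ONE FINITE-DIMENSIONAL SUBSPACE** under admissibility on irreducible `K`-types: for `ψ` `K`-finite
(★ `IsTranslationFinite`) there is a finite-dimensional `W ≤ H` with `σ(ψ)v ∈ W` for every `v ∈ H` — the `F_ψ`-part of §2, finite-dimensional by §1
(the left regular representation on `F_ψ` is weakly continuous: `k ↦ λ(k)φ` is continuous in `C(K, ℂ)` and linear functionals on the finite-dimensional `F_ψ` are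
continuous). [cite: WallachRRG1, §3.3.1] [cite: BrockerTomDieck1985, III (5.6)–(5.7)] -/
theorem exists_finiteDimensional_forall_smear_mem (hc : σ.IsStronglyContinuous)
    (hadm : ∀ (E : Submodule ℂ H) (hE : ∀ k, ∀ x ∈ E, σ k x ∈ E), FiniteDimensional ℂ E → (σ.subRep E hE).IsIrreducible →
      FiniteDimensional ℂ (Representation.homRangeSum σ.toRepresentation (σ.subRep E hE)))
    {ψ : C(K, ℂ)} (hψ : IsTranslationFinite ψ) :
    ∃ W : Submodule ℂ H, FiniteDimensional ℂ W ∧ ∀ v : H, smear σ μ ψ v ∈ W := by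
  obtain ⟨F₀, hF₀, hψF₀⟩ := hψ
  -- the span `F` of the translates: finite-dimensional, translation-stable, contains `ψ`
  set F : Submodule ℂ C(K, ℂ) := Submodule.span ℂ (Set.range fun g : K => leftTranslate g ψ) with hF_def
  have hFle : F ≤ F₀ := Submodule.span_le.2 (by rintro _ ⟨g, rfl⟩; exact hψF₀ g)
  haveI : FiniteDimensional ℂ F₀ := hF₀
  haveI hFfin : FiniteDimensional ℂ F := Submodule.finiteDimensional_of_le hFle
  have hF : ∀ k, ∀ φ ∈ F, leftTranslate k φ ∈ F := fun k φ hφ => leftTranslate_mem_span_range ψ k hφ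
  have hψF : ψ ∈ F := by
    have : leftTranslate (1 : K) ψ = ψ := leftTranslate_one ψ
    rw [← this]
    exact Submodule.subset_span ⟨1, rfl⟩
  let S : Subrepresentation ((ContRepresentation.trivial ℂ K ℂ).coind₁).toRepresentation := ⟨F, fun k φ hφ => hF k φ hφ⟩
  -- weak continuity of the left regular representation on `F`
  have hcont : ∀ (φ : S.toSubmodule) (ℓ : Module.Dual ℂ S.toSubmodule), Continuous fun k : K => ℓ (S.toRepresentation k φ) := by
    intro φ ℓ
    have h1 : Continuous fun k : K => S.toRepresentation k φ := by
      refine continuous_induced_rng.2 ?_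
      have : (Subtype.val ∘ fun k : K => S.toRepresentation k φ) = fun k => leftTranslate k (φ : C(K, ℂ)) := by
        funext k
        rfl
      rw [this]
      exact continuous_leftTranslate _
    haveI : FiniteDimensional ℂ S.toSubmodule := hFfin
    exact (LinearMap.continuous_of_finiteDimensional ℓ).comp h1
  haveI hW : FiniteDimensional ℂ (Representation.homRangeSum σ.toRepresentation S.toRepresentation) :=
    finiteDimensional_homRangeSum_of_admissible hadm S.toRepresentation hcont
  exact ⟨_, hW, fun v => smear_mem_homRangeSum hc F hF hψF v⟩

/-! ## §3 Operator form: `σ(ψ)` is a finite-rank, hence compact, operator -/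

/-- **THE INTEGRATED OPERATOR OF A `K`-FINITE FUNCTION IS COMPACT** under admissibility on irreducible `K`-types: for `σ` unitary and strongly continuous,
`μ` a left Haar measure on the compact group `K` and `ψ` `K`-finite, `σ(ψ) = ∫ ψ(k)σ(k) dμ` (★ `ContRepresentation.integratedOperator`; ★
`smear_eq_integratedOperator`) takes values in one finite-dimensional subspace (§2), so it factors through a finite-dimensional space and is a compact operator
(Mathlib `isCompactOperator_of_locallyCompactSpace_dom`). [cite: DeitmarEchterhoff2014, Prop. 6.2.1] [cite: WallachRRG1, §3.3.1] -/
theorem isCompactOperator_integratedOperator_of_isTranslationFinite (hu : σ.IsUnitary) (hc : σ.IsStronglyContinuous)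
    (hadm : ∀ (E : Submodule ℂ H) (hE : ∀ k, ∀ x ∈ E, σ k x ∈ E), FiniteDimensional ℂ E → (σ.subRep E hE).IsIrreducible →
      FiniteDimensional ℂ (Representation.homRangeSum σ.toRepresentation (σ.subRep E hE)))
    {ψ : C(K, ℂ)} (hψ : IsTranslationFinite ψ) :
    IsCompactOperator (σ.integratedOperator hu hc μ ⟨ψ, HasCompactSupport.of_compactSpace ψ⟩) := by
  obtain ⟨W, hW, hmem⟩ := exists_finiteDimensional_forall_smear_mem (μ := μ) hc hadm hψ
  haveI : FiniteDimensional ℂ W := hW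
  set A : H →L[ℂ] H := σ.integratedOperator hu hc μ ⟨ψ, HasCompactSupport.of_compactSpace ψ⟩ with hA
  have hAW : ∀ v, A v ∈ W := fun v => by
    rw [hA, ← smear_eq_integratedOperator hu hc μ ψ v]
    exact hmem v
  have h1 : IsCompactOperator (A.codRestrict W hAW) := isCompactOperator_of_locallyCompactSpace_dom _
  have h3 : (W.subtypeL : W → H) ∘ (A.codRestrict W hAW) = A := funext fun v => rfl
  exact h3 ▸ h1.clm_comp W.subtypeL

end Smear

end Summit.HodgeConjecture.HodgeConjecture.Cruxes.H413.K2E1AdmissibleSmearFiniteRank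

end
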